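import Literature.Analysis.ValidatedNumerics.QuadCertTree
import HarnessLib

/-!
# Text format and decoder for `QuadCert` certificate trees (`QuadCert`, part 3)

Topic `Literature/Analysis/ValidatedNumerics`.  Realistic certificate trees (`QuadCertTree.lean`) have `10⁴–10⁵` steps
and are shipped as a STRING of whitespace-separated decimal integers, decoded inside `native_decide` (elaborating the
same data as a Lean term would be far slower than parsing it at run time; cf. the census replayer
`Literature/Geometry/DiscreteGeometry/ShellCensusReplay.lean`, whose tokenizer this file mirrors).  Nothing here needs
proof: soundness is `Tree.sound` applied to WHATEVER tree the decoder returns. [folklore]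

Grammar (tokens are integers; a rational is TWO tokens `p e` meaning `p / 2^e`, `e ≥ 0`):
```
poly  := c:rat nLin (i a:rat)^nLin nQuad (i j b:rat)^nQuad
step  := target:poly nLam (i λ:rat)^nLam nMu (j μ:poly)^nMu nProd (a b κ:rat)^nProd nSos (d:rat ℓ:poly)^nSos cst:rat
tree  := 0 step tree                      -- Tree.step
       | 1 a c:rat f:poly step tree       -- Tree.div
       | 2 ℓ:poly tree tree               -- Tree.split (nonnegative branch first)
       | 3 step                           -- Tree.contra
       | 4 <goal> nIdx idx^nIdx           -- Tree.goal; <goal> read by the user-supplied goal decoder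
```
`Tree.ofText dg s` tokenizes `s` (any character other than a digit or `-` separates), and decodes one tree with the
goal decoder `dg : Array ℤ → ℕ → Option (γ × ℕ)` (position in, specification and next position out); malformed
input yields `none` (and `Tree.checkText … = false`).

## References
* R. E. Moore, *Interval Analysis* (1966), §4.4 — certificates as data replayed by exact arithmetic. [cite: Moore1966, §4.4]
-/

namespace Literature.Analysis.ValidatedNumerics

namespace QuadCert

namespace Text

/-! ### Tokenizer -/

/-- Tokenizer state: tokens so far, current magnitude, inside a number, pending minus sign. [folklore] -/
structure PState where
  /-- tokens read so far -/
  toks : Array ℤ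
  /-- magnitude of the number being read -/
  cur : ℕ
  /-- a digit of the current number has been seen -/
  inNum : Bool
  /-- a minus sign precedes the current number -/
  neg : Bool

/-- Emit the pending number, if any. [folklore] -/
def flush (st : PState) : PState :=
  if st.inNum then
    { toks := st.toks.push (if st.neg then -(st.cur : ℤ) else (st.cur : ℤ)), cur := 0, inNum := false, neg := false }
  else { st with neg := false }

/-- Consume one character. [folklore] -/
def stepChar (st : PState) (c : Char) : PState :=
  if c.isDigit then { st with cur := st.cur * 10 + (c.toNat - 48), inNum := true }
  else if c = '-' then { flush st with neg := true }
  else flush st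

/-- **Tokenize** a string into integers. [folklore] -/
def tokens (s : String) : Array ℤ := (flush (s.foldl stepChar ⟨#[], 0, false, false⟩)).toks

/-! ### Readers -/

/-- Token `i` (`0` beyond the end). [folklore] -/
def intAt (ts : Array ℤ) (i : ℕ) : ℤ := ts.getD i 0

/-- Token `i` as a natural number. [folklore] -/
def natAt (ts : Array ℤ) (i : ℕ) : ℕ := (intAt ts i).toNat

/-- Tokens `i, i+1` as the dyadic rational `p / 2^e`. [folklore] -/
def ratAt (ts : Array ℤ) (i : ℕ) : ℚ := (intAt ts i : ℚ) / ((2 : ℚ) ^ natAt ts (i + 1))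

/-- Read `n` naturals. [folklore] -/
def readNats (ts : Array ℤ) : ℕ → ℕ → List ℕ × ℕ
  | 0, i => ([], i)
  | n + 1, i =>
    let r := readNats ts n (i + 1)
    (natAt ts i :: r.1, r.2)

/-- Read `n` linear terms `i a`. [folklore] -/
def readLin (ts : Array ℤ) : ℕ → ℕ → List (ℕ × ℚ) × ℕ
  | 0, i => ([], i)
  | n + 1, i =>
    let r := readLin ts n (i + 3)
    ((natAt ts i, ratAt ts (i + 1)) :: r.1, r.2)

/-- Read `n` quadratic terms `i j b`. [folklore] -/
def readQuad (ts : Array ℤ) : ℕ → ℕ → List (ℕ × ℕ × ℚ) × ℕ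
  | 0, i => ([], i)
  | n + 1, i =>
    let r := readQuad ts n (i + 4)
    ((natAt ts i, natAt ts (i + 1), ratAt ts (i + 2)) :: r.1, r.2)

/-- Read a polynomial. [folklore] -/
def readPoly (ts : Array ℤ) (i : ℕ) : QPoly × ℕ :=
  let c := ratAt ts i
  let l := readLin ts (natAt ts (i + 2)) (i + 3)
  let q := readQuad ts (natAt ts l.2) (l.2 + 1)
  (⟨c, l.1, q.1⟩, q.2)

/-- Read `n` equation multipliers `j μ`. [folklore] -/
def readMu (ts : Array ℤ) : ℕ → ℕ → List (ℕ × QPoly) × ℕ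
  | 0, i => ([], i)
  | n + 1, i =>
    let p := readPoly ts (i + 1)
    let r := readMu ts n p.2
    ((natAt ts i, p.1) :: r.1, r.2)

/-- Read `n` product multipliers `a b κ`. [folklore] -/
def readProds (ts : Array ℤ) : ℕ → ℕ → List (ℕ × ℕ × ℚ) × ℕ
  | 0, i => ([], i)
  | n + 1, i =>
    let r := readProds ts n (i + 4)
    ((natAt ts i, natAt ts (i + 1), ratAt ts (i + 2)) :: r.1, r.2)

/-- Read `n` weighted squares `d ℓ`. [folklore] -/
def readSos (ts : Array ℤ) : ℕ → ℕ → List (ℚ × QPoly) × ℕ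
  | 0, i => ([], i)
  | n + 1, i =>
    let p := readPoly ts (i + 2)
    let r := readSos ts n p.2
    ((ratAt ts i, p.1) :: r.1, r.2)

/-- Read a step. [folklore] -/
def readStep (ts : Array ℤ) (i : ℕ) : Step × ℕ :=
  let tg := readPoly ts i
  let la := readLin ts (natAt ts tg.2) (tg.2 + 1)
  let mu := readMu ts (natAt ts la.2) (la.2 + 1)
  let pr := readProds ts (natAt ts mu.2) (mu.2 + 1)
  let so := readSos ts (natAt ts pr.2) (pr.2 + 1)
  ({ target := tg.1, lam := la.1, mu := mu.1, prods := pr.1, sos := so.1, cst := ratAt ts so.2 }, so.2 + 2)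

variable {γ : Type}

/-- Decode a tree at position `i` (`fuel` bounds the number of nodes on a root path plus siblings visited; the
token count always suffices). [folklore] -/
def decodeTree (dg : Array ℤ → ℕ → Option (γ × ℕ)) (ts : Array ℤ) : ℕ → ℕ → Option (Tree γ × ℕ)
  | 0, _ => none
  | fuel + 1, i =>
    let tag := intAt ts i
    if tag = 0 then
      let s := readStep ts (i + 1)
      match decodeTree dg ts fuel s.2 with
      | some (t, j) => some (.step s.1 t, j)
      | none => none
    else if tag = 1 then
      let a := natAt ts (i + 1)
      let c := ratAt ts (i + 2)
      let f := readPoly ts (i + 4)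
      let s := readStep ts f.2
      match decodeTree dg ts fuel s.2 with
      | some (t, j) => some (.div a c f.1 s.1 t, j)
      | none => none
    else if tag = 2 then
      let l := readPoly ts (i + 1)
      match decodeTree dg ts fuel l.2 with
      | some (tp, j) =>
        match decodeTree dg ts fuel j with
        | some (tn, k) => some (.split l.1 tp tn, k)
        | none => none
      | none => none
    else if tag = 3 then
      let s := readStep ts (i + 1)
      some (.contra s.1, s.2)
    else if tag = 4 then
      match dg ts (i + 1) with
      | some (g, j) =>
        let ix := readNats ts (natAt ts j) (j + 1)
        some (.goal g ix.1, ix.2)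
      | none => none
    else none

end Text

/-- **Decode a certificate tree from text** (`none` if malformed). [folklore] -/
def Tree.ofText {γ : Type} (dg : Array ℤ → ℕ → Option (γ × ℕ)) (s : String) : Option (Tree γ) :=
  let ts := Text.tokens s
  (Text.decodeTree dg ts (ts.size + 1) 0).map (·.1)

/-- Check a textual certificate on a context (`false` if malformed). [folklore] -/
def Tree.checkText {γ : Type} (dg : Array ℤ → ℕ → Option (γ × ℕ)) (gp : γ → Option (List QPoly)) (Γ : Ctx)
    (s : String) : Bool :=
  match Tree.ofText dg s with
  | some t => t.check gp Γ
  | none => false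

/-- **Soundness of textual certificates**: an accepted text certifies its context — every point satisfying the
context satisfies all goal polynomials of some well-formed goal specification. [cite: Lasserre2001, Thm 4.2] -/
theorem sound_of_checkText {γ : Type} {dg : Array ℤ → ℕ → Option (γ × ℕ)} {gp : γ → Option (List QPoly)}
    {Γ : Ctx} {s : String} (h : Tree.checkText dg gp Γ s = true) {x : ℕ → ℝ} (hx : Γ.Holds x) :
    ∃ (spec : γ) (qs : List QPoly), gp spec = some qs ∧ ∀ q ∈ qs, 0 ≤ q.eval x := by
  unfold Tree.checkText at h
  split at h
  · rename_i t _
    exact Tree.sound gp t Γ h hx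
  · cases h

/-! ### A toy (the toy tree of `QuadCertTree.lean`, goal specifications read as one natural-number token) -/

/-- Goal decoder of the toy: one natural-number token. [folklore] -/
def toyDecode (ts : Array ℤ) (i : ℕ) : Option (ℕ × ℕ) := some (Text.natAt ts i, i + 1)

/-- The toy tree of `QuadCertTree.lean` as a token stream (the text
`"2 0 0 2 0 1 0 1 -1 0 0  0 1 0 1 1 -2 0 0 2 2 1 0 3 1 0 0 0 0 0 0 4 1 1 4  0 1 0 1 0 -2 0 0 2 2 1 0 3 1 0 0 0 0 0 0 4 0 1 4"`
tokenizes to it). [folklore] -/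
def toyToks : Array ℤ :=
  #[2, 0, 0, 2, 0, 1, 0, 1, -1, 0, 0,
    0, 1, 0, 1, 1, -2, 0, 0, 2, 2, 1, 0, 3, 1, 0, 0, 0, 0, 0, 0, 4, 1, 1, 4,
    0, 1, 0, 1, 0, -2, 0, 0, 2, 2, 1, 0, 3, 1, 0, 0, 0, 0, 0, 0, 4, 0, 1, 4]

/-- The toy tokens decode to a tree (kernel evaluation; it is `toyTree` — `Tree` carries no `DecidableEq`, so only
definedness is stated here). [folklore] -/
example : (Text.decodeTree toyDecode toyToks (toyToks.size + 1) 0).isSome = true := by decide +kernel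

end QuadCert

end Literature.Analysis.ValidatedNumerics
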